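import Literature.Barriers.Schanuel.LinearSubgroupMethodLimit
import Literature.Barriers.Schanuel.AlgebraicIndependenceOfLogarithmsRankProofs
import Literature.NumberTheory.Transcendental.SixExponentialsSeveralVariables
import HarnessLib

/-!
# Barrier (Schanuel): Roy's Theorem 1.2 from Waldschmidt's Théorème 2.1 — proofs

Second sibling proof file of `Literature/Barriers/Schanuel/LinearSubgroupMethodLimit.lean` (the
first, `LinearSubgroupMethodLimitProofs.lean`, discharges Roy's Theorem 3.4), whose named
fact `Literature.Barriers.Schanuel.waldschmidt1981_linearSubgroup_matrix` is Roy's quotation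
(Acta Math. 175 (1995), §1 Theorem 1.2) of M. Waldschmidt's linear subgroup theorem for matrices
of logarithms of algebraic numbers, Invent. Math. 63 (1981), Théorème 2.1 — vendored verbatim as
`Literature.NumberTheory.Transcendental.Waldschmidt1981.thm_2_1`
(`Literature/NumberTheory/Transcendental/SixExponentialsSeveralVariables.lean`).

This file proves that the quotation follows from the original:
`waldschmidt1981_linearSubgroup_matrix_of_thm_2_1`. The printed Théorème 2.1 is the stronger
statement on three counts, and the proof is the corresponding bookkeeping:

* hypotheses: Roy's `M ∈ M_{d,l}(𝓛)` with `𝓛` "the `ℚ`-subspace of `K` generated by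
  `exp⁻¹(ℚ̄^×)`" [Roy1995, §1] means every entry lies in the `ℚ`-span of the logarithms of
  algebraic numbers; that span *is* the set of logarithms of algebraic numbers
  (`Literature.Barriers.Schanuel.isAlgebraic_cexp_of_mem_logQSpan`: `e^{x+y} = e^x e^y`,
  `(e^{qx})^{den q} = (e^x)^{num q}`), so the entries are "logarithmes de nombres algébriques" as
  Théorème 2.1 requires; Roy's `r < dl/(d+l)` is `LSTHypothesis d l (rank M)` verbatim;
* change of bases: `P ∈ SL_d(ℤ)`, `Q ∈ SL_ℓ(ℤ)` [Waldschmidt1981, Thm 2.1] give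
  `P ∈ GL_d(ℚ)`, `Q ∈ GL_l(ℚ)` [Roy1995, Thm 1.2] by the embedding `ℤ ↪ ℚ` (`det = 1` is a unit),
  and `(P_ℚ).map (algebraMap ℚ ℂ) = P.map (Int.castRingHom ℂ)`, so the product `PMQ`, its zero
  block and its block `M₁` are literally the same complex matrices;
* conclusions: `d₁/r₁ > d/r` (strict, `d · r₁ < d₁ · r`) gives Roy's `d₁/r₁ ≥ d/r`
  (`d · r₁ ≤ d₁ · r`), and `ℓ₁ d₁ ≤ r₁(ℓ₁ + d₁)` is `d₁ l₁ ≤ r₁(d₁ + l₁)`.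

The discharge `waldschmidt1981_linearSubgroup_matrix_holds` will be appended here once
`Waldschmidt1981.thm_2_1` is itself discharged (bottom-up through Théorème 1.1, Proposition 6.1,
Corollaire 4.2 of [Waldschmidt1981]; see the module docstring of
`SixExponentialsSeveralVariables.lean`).

## References

* [Roy1995] D. Roy, *Points whose coordinates are logarithms of algebraic numbers on algebraic
  varieties*, Acta Math. 175 (1995) 49–73, §1 (definition of `𝓛`), Theorem 1.2 (p. 52).
* [Waldschmidt1981] M. Waldschmidt, *Transcendance et exponentielles en plusieurs variables*,
  Invent. Math. 63 (1981) 97–127, §2 Théorème 2.1 (p. 100).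
-/

noncomputable section

open Complex Matrix

namespace Literature.Barriers.Schanuel

/-- Base change `ℤ ↪ ℚ ↪ ℂ` on matrices: mapping an integer matrix to `ℚ` and then along
`algebraMap ℚ ℂ` is mapping it along `ℤ → ℂ`. [folklore] -/
theorem map_intCast_map_algebraMap {m n : Type*} (P : Matrix m n ℤ) :
    (P.map (Int.castRingHom ℚ)).map (algebraMap ℚ ℂ) = P.map (Int.castRingHom ℂ) := by
  rw [Matrix.map_map]
  congr 1

/-- An integer matrix of determinant `1` becomes an invertible rational matrix
(`SL_d(ℤ) → GL_d(ℚ)`). [folklore] -/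
theorem isUnit_map_intCast_of_det_eq_one {m : Type*} [Fintype m] [DecidableEq m]
    {P : Matrix m m ℤ} (hP : P.det = 1) : IsUnit (P.map (Int.castRingHom ℚ)) := by
  rw [Matrix.isUnit_iff_isUnit_det, ← RingHom.mapMatrix_apply, ← RingHom.map_det, hP, map_one]
  exact isUnit_one

/-- **Roy's Theorem 1.2 follows from Waldschmidt's Théorème 2.1.** The named fact
`waldschmidt1981_linearSubgroup_matrix` (Roy 1995, Thm 1.2: `P ∈ GL_d(ℚ)`, `Q ∈ GL_l(ℚ)`,
`r₁ > 0`, `d₁/r₁ ≥ d/r`, `d₁l₁ ≤ r₁(d₁ + l₁)`, entries in `𝓛 = span_ℚ exp⁻¹(ℚ̄^×)`) is a formal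
consequence of the original statement `Waldschmidt1981.thm_2_1` (`P ∈ SL_d(ℤ)`, `Q ∈ SL_ℓ(ℤ)`,
`d₁/r₁ > d/r`, entries logarithms of algebraic numbers): the entries of a matrix of `M_{d,l}(𝓛)`
are logarithms of algebraic numbers (`isAlgebraic_cexp_of_mem_logQSpan`), integer matrices of
determinant one are invertible over `ℚ`, and the printed inequalities are the stronger ones.
[cite: Roy1995, §1 Theorem 1.2 (p. 52), quoting Waldschmidt1981 Théorème 2.1] -/
theorem waldschmidt1981_linearSubgroup_matrix_of_thm_2_1
    (h : Literature.NumberTheory.Transcendental.Waldschmidt1981.thm_2_1) :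
    waldschmidt1981_linearSubgroup_matrix := by
  intro d l M _hd _hl hM hrows hcols hLST
  have halg : ∀ i j, IsAlgebraic ℚ (cexp (M i j)) := fun i j =>
    isAlgebraic_cexp_of_mem_logQSpan (hM i j)
  have hr : M.rank * (d + l) < d * l := hLST
  obtain ⟨P, Q, hP, hQ, d₁, l₁, r₁, hd₁, hl₁, hr₁, h1, h2, hzero, hrank⟩ :=
    h M halg hrows hcols hr
  refine ⟨P.map (Int.castRingHom ℚ), Q.map (Int.castRingHom ℚ),
    isUnit_map_intCast_of_det_eq_one hP, isUnit_map_intCast_of_det_eq_one hQ,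
    d₁, l₁, r₁, hd₁, hl₁, hr₁, h1.le, ?_, ?_, ?_⟩
  · calc d₁ * l₁ = l₁ * d₁ := Nat.mul_comm _ _
      _ ≤ r₁ * (l₁ + d₁) := h2
      _ = r₁ * (d₁ + l₁) := by rw [Nat.add_comm]
  · intro i j hi hj
    rw [map_intCast_map_algebraMap, map_intCast_map_algebraMap]
    exact hzero i j hi hj
  · rw [map_intCast_map_algebraMap, map_intCast_map_algebraMap]
    exact hrank

end Literature.Barriers.Schanuel

end
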